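import Literature.Barriers.PneNP.TSPExtensionComplexityGadgetXor
import HarnessLib

/-!
# The TSP gadget graph: the blocks of the designated tours

Support file for the discharge of `Literature.Barriers.PneNP.TSPExtensionComplexity` (FMPTW
2015, Thm. 12). For every `b ⊆ [n]` we shall exhibit (next file) a tour `T_b` of the complete
graph on `GV n pad`, inside the gadget graph, with bits `B_i(T_b) = [i ∈ b]` and pair
indicators `Y_{ij}(T_b) = [i ∈ b ∧ j ∈ b]`. The tour is a concatenation of BLOCKS, each a path
of the gadget graph beginning and ending at skeleton vertices, keyed by its first vertex:

* `chainBlock b i` (key `g i false`): `g i false`, then — if `i ∉ b` — the bottom-mode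
  serpentines `botPath i 0, …, botPath i (n-1)` of the whole chain of `i`, then `g i true`;
* `pairBlock b y x` for `y < x` (key = buffer `a x y 0`, last = buffer `a x y 1`): the
  triangle `P = a y x 0, Q = a y x 1, R = a y x 2` with `topPath y x` inserted between `P, Q`
  iff `y ∈ b` and `topPath x y` between `Q, R` iff `x ∈ b`, ordered so that `R, P` are
  consecutive iff NOT both bits are set (`pairBody`);
* `diagBlock b i` (key `a i i 0`): the dummy anchors of the diagonal gadget with `topPath i i`
  in between iff `i ∈ b`;
* singletons for the free skeleton vertices `a x y 2` (`y ≤ x`) and the padding.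

Here: the definitions (`blk b : GV n pad → List (GV n pad)`, `owner b`), that every vertex
lies in the block of its owner and in no other block (`mem_blk_iff_owner`), that blocks have
no repetitions (`nodup_blk`), are paths of the gadget graph (`isChain_blk`) and start and end
on the skeleton (`skel_head_blk`, `skel_getLast_blk`). All [folklore].
-/

namespace Literature.Barriers.PneNP

open GV Finset

variable {n pad : ℕ} (b : Finset (Fin n))

/-! ### The chain of `i` in bottom mode -/

/-- The last `m` gadgets of the chain of `i`, in bottom mode: `botPath i (n-m) ++ ⋯ ++
botPath i (n-1)`. [folklore] -/
def chainTail (i : Fin n) : (m : ℕ) → m ≤ n → List (GV n pad)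
  | 0, _ => []
  | m + 1, h => botPath i ⟨n - (m + 1), by omega⟩ ++ chainTail i m (by omega)

/-- The whole chain of `i` in bottom mode. [folklore] -/
def chainBody (i : Fin n) : List (GV n pad) := chainTail i n le_rfl

/-- Membership in `chainTail`. [folklore] -/
theorem mem_chainTail_iff (i : Fin n) :
    ∀ (m : ℕ) (hm : m ≤ n) (v : GV n pad),
      v ∈ chainTail i m hm ↔ ∃ (j : Fin n) (r : Fin 3) (c : Fin 4), n - m ≤ j ∧ v = x i j r c
  | 0, _, v => by
    simp only [chainTail, List.not_mem_nil, false_iff, not_exists, not_and]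
    intro j _ _ hj
    have := j.2; omega
  | m + 1, hm, v => by
    rw [chainTail, List.mem_append, mem_botPath_iff, mem_chainTail_iff i m (by omega) v]
    constructor
    · rintro (⟨r, c, rfl⟩ | ⟨j, r, c, hj, rfl⟩)
      · exact ⟨_, r, c, le_rfl, rfl⟩
      · exact ⟨j, r, c, by omega, rfl⟩
    · rintro ⟨j, r, c, hj, rfl⟩
      by_cases hj' : (j : ℕ) = n - (m + 1)
      · left
        refine ⟨r, c, ?_⟩
        congr
        exact Fin.ext hj'
      · exact Or.inr ⟨j, r, c, by omega, rfl⟩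

/-- Membership in `chainBody`: the vertices of the gadgets `X_(i,·)`. [folklore] -/
theorem mem_chainBody_iff (i : Fin n) (v : GV n pad) :
    v ∈ chainBody i ↔ ∃ (j : Fin n) (r : Fin 3) (c : Fin 4), v = x i j r c := by
  rw [chainBody, mem_chainTail_iff]
  simp

/-- `chainTail` has no repetition. [folklore] -/
theorem nodup_chainTail (i : Fin n) : ∀ (m : ℕ) (hm : m ≤ n), (chainTail i m hm : List (GV n pad)).Nodup
  | 0, _ => List.nodup_nil
  | m + 1, hm => by
    rw [chainTail, List.nodup_append]
    refine ⟨nodup_botPath _ _, nodup_chainTail i m (by omega), ?_⟩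
    intro v hv w hw hvw
    subst hvw
    obtain ⟨r, c, rfl⟩ := mem_botPath_iff.1 hv
    obtain ⟨j, r', c', hj, h⟩ := (mem_chainTail_iff i m (by omega) _).1 hw
    simp only [GV.x.injEq] at h
    obtain ⟨-, rfl, -, -⟩ := h
    simp at hj
    omega

/-- `chainTail (m+1)` starts at `s₀` of gadget `n-(m+1)`. [folklore] -/
theorem head?_chainTail_succ (i : Fin n) (m : ℕ) (hm : m + 1 ≤ n) :
    (chainTail i (m + 1) hm : List (GV n pad)).head? = some (x i ⟨n - (m + 1), by omega⟩ 2 0) := by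
  rw [chainTail, List.head?_append, head?_botPath]
  rfl

/-- `chainTail (m+1)` ends at `s₃` of gadget `n-1`. [folklore] -/
theorem getLast?_chainTail_succ (i : Fin n) :
    ∀ (m : ℕ) (hm : m + 1 ≤ n),
      (chainTail i (m + 1) hm : List (GV n pad)).getLast? = some (x i ⟨n - 1, by omega⟩ 2 3)
  | 0, hm => by
    rw [chainTail, chainTail, List.append_nil, getLast?_botPath]
  | m + 1, hm => by
    rw [chainTail, List.getLast?_append, getLast?_chainTail_succ i m (by omega)]
    rfl

/-- `chainTail` is a path of the gadget graph. [folklore] -/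
theorem isChain_chainTail (i : Fin n) :
    ∀ (m : ℕ) (hm : m ≤ n), List.IsChain (gadgetGraph n pad).Adj (chainTail i m hm)
  | 0, _ => List.isChain_nil
  | m + 1, hm => by
    rw [chainTail]
    refine List.IsChain.append (isChain_adj_botPath _ _) (isChain_chainTail i m (by omega)) ?_
    intro u hu v hv
    rw [getLast?_botPath] at hu
    simp only [Option.mem_def, Option.some.injEq] at hu
    subst hu
    cases m with
    | zero => simp [chainTail] at hv
    | succ m =>
      rw [head?_chainTail_succ] at hv
      simp only [Option.mem_def, Option.some.injEq] at hv
      subst hv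
      refine adj_bot_iff.2 (Or.inr (Or.inr ?_))
      rw [sNext_three]
      symm
      rw [chR_eq_x_iff]
      exact ⟨rfl, by simp only; omega, rfl, rfl⟩

/-! ### The blocks -/

/-- Block of the chain of `i`: `g i false`, the chain in bottom mode if `i ∉ b`, `g i true`.
[folklore] -/
def chainBlock (i : Fin n) : List (GV n pad) :=
  g i false :: ((if i ∈ b then [] else chainBody i) ++ [g i true])

/-- Body of the block of the pair `y < x`: the triangle `P = a y x 0`, `Q = a y x 1`,
`R = a y x 2`, with the top rows of `X_(y,x)` (between `P, Q`) and `X_(x,y)` (between `Q, R`)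
inserted according to the bits, and `R, P` consecutive iff not both bits are set.
[folklore] -/
def pairBody (y x : Fin n) : List (GV n pad) :=
  if y ∈ b then
    (if x ∈ b then a y x 0 :: (topPath y x ++ a y x 1 :: (topPath x y ++ [a y x 2]))
     else a y x 2 :: a y x 0 :: (topPath y x ++ [a y x 1]))
  else
    (if x ∈ b then a y x 1 :: (topPath x y ++ [a y x 2, a y x 0])
     else [a y x 2, a y x 0, a y x 1])

/-- Block of the pair `y < x`, between its two buffers `a x y 0`, `a x y 1`. [folklore] -/
def pairBlock (y x : Fin n) : List (GV n pad) := a x y 0 :: (pairBody b y x ++ [a x y 1])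

/-- Block of the diagonal gadget `X_(i,i)`, between its dummy anchors. [folklore] -/
def diagBlock (i : Fin n) : List (GV n pad) :=
  a i i 0 :: ((if i ∈ b then topPath i i else []) ++ [a i i 1])

/-- The block keyed by a vertex (empty for non-keys). [folklore] -/
def blk : GV n pad → List (GV n pad)
  | g i false => chainBlock b i
  | g _ true => []
  | a i j c =>
      if j < i then (if c = 0 then pairBlock b j i else if c = 1 then [] else [a i j c])
      else if i = j then (if c = 0 then diagBlock b i else if c = 1 then [] else [a i j c])
      else []
  | x _ _ _ _ => []
  | d t => [d t]

/-- The key of the block containing a vertex. [folklore] -/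
def owner : GV n pad → GV n pad
  | g i _ => g i false
  | a i j c =>
      if j < i then (if c = 2 then a i j 2 else a i j 0)
      else if i = j then (if c = 2 then a i j 2 else a i j 0)
      else a j i 0
  | x i j _ _ => if i ∈ b then (if i = j then a i i 0 else if i < j then a j i 0 else a i j 0)
      else g i false
  | d t => d t

/-! ### Membership in the blocks -/

/-- Members of `pairBody`. [folklore] -/
theorem mem_pairBody_iff {y x' : Fin n} {v : GV n pad} :
    v ∈ pairBody b y x' ↔ (v = a y x' 0 ∨ v = a y x' 1 ∨ v = a y x' 2) ∨
      (y ∈ b ∧ v ∈ topPath y x') ∨ (x' ∈ b ∧ v ∈ topPath x' y) := by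
  unfold pairBody
  by_cases hy : y ∈ b <;> by_cases hx : x' ∈ b <;>
    simp only [List.mem_cons, List.mem_append, List.not_mem_nil, hy, hx, true_and, false_and,
      or_false, false_or, if_true, if_false] <;> tauto

/-- Members of `chainBlock`. [folklore] -/
theorem mem_chainBlock_iff {i : Fin n} {v : GV n pad} :
    v ∈ chainBlock b i ↔ v = g i false ∨ v = g i true ∨ (i ∉ b ∧ ∃ j r c, v = x i j r c) := by
  unfold chainBlock
  split_ifs with hi
  · simp [hi]
  · rw [List.mem_cons, List.mem_append, mem_chainBody_iff, List.mem_singleton]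
    simp only [hi, not_false_eq_true, true_and]
    constructor
    · rintro (h | h | h)
      exacts [Or.inl h, Or.inr (Or.inr h), Or.inr (Or.inl h)]
    · rintro (h | h | h)
      exacts [Or.inl h, Or.inr (Or.inr h), Or.inr (Or.inl h)]

/-- Members of `diagBlock`. [folklore] -/
theorem mem_diagBlock_iff {i : Fin n} {v : GV n pad} :
    v ∈ diagBlock b i ↔ v = a i i 0 ∨ v = a i i 1 ∨ (i ∈ b ∧ ∃ r c, v = x i i r c) := by
  unfold diagBlock
  split_ifs with hi
  · rw [List.mem_cons, List.mem_append, mem_topPath_iff, List.mem_singleton]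
    simp only [hi, true_and]
    constructor
    · rintro (h | h | h)
      exacts [Or.inl h, Or.inr (Or.inr h), Or.inr (Or.inl h)]
    · rintro (h | h | h)
      exacts [Or.inl h, Or.inr (Or.inr h), Or.inr (Or.inl h)]
  · simp [hi]

/-- Members of `pairBlock`. [folklore] -/
theorem mem_pairBlock_iff {y x' : Fin n} {v : GV n pad} :
    v ∈ pairBlock b y x' ↔ v = a x' y 0 ∨ v = a x' y 1 ∨ v ∈ pairBody b y x' := by
  unfold pairBlock
  simp only [List.mem_cons, List.mem_append]
  tauto

/-- **Every vertex lies in the block of its owner.** [folklore] -/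
theorem mem_blk_owner (v : GV n pad) : v ∈ blk b (owner b v) := by
  cases v with
  | g i s =>
    simp only [owner, blk]
    rw [mem_chainBlock_iff]
    cases s
    · exact Or.inl rfl
    · exact Or.inr (Or.inl rfl)
  | a i j c =>
    simp only [owner]
    by_cases hji : j < i
    · simp only [hji, if_true]
      by_cases hc : c = 2
      · simp only [hc, if_true, blk, hji]
        simp
      · simp only [hc, if_false, blk, hji, if_true]
        rw [mem_pairBlock_iff]
        have : c = 0 ∨ c = 1 := by
          rcases c with ⟨c, hc'⟩
          simp only [Fin.ext_iff, Fin.val_zero, Fin.val_one] at hc ⊢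
          simp at hc
          omega
        rcases this with rfl | rfl
        · exact Or.inl rfl
        · exact Or.inr (Or.inl rfl)
    · simp only [hji, if_false]
      by_cases hij : i = j
      · subst hij
        simp only [if_true]
        by_cases hc : c = 2
        · simp only [hc, if_true, blk, lt_irrefl, if_false]
          simp
        · simp only [hc, if_false, blk, lt_irrefl, if_true]
          rw [mem_diagBlock_iff]
          have : c = 0 ∨ c = 1 := by
            rcases c with ⟨c, hc'⟩
            simp [Fin.ext_iff] at hc ⊢
            omega
          rcases this with rfl | rfl
          · exact Or.inl rfl
          · exact Or.inr (Or.inl rfl)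
      · simp only [hij, if_false]
        have hlt : i < j := lt_of_le_of_ne (not_lt.1 hji) hij
        simp only [blk, hlt, if_true]
        rw [mem_pairBlock_iff, mem_pairBody_iff]
        right; right; left
        have : c = 0 ∨ c = 1 ∨ c = 2 := by
          rcases c with ⟨c, hc'⟩
          simp [Fin.ext_iff]
          omega
        rcases this with rfl | rfl | rfl
        · exact Or.inl rfl
        · exact Or.inr (Or.inl rfl)
        · exact Or.inr (Or.inr rfl)
  | x i j r c =>
    simp only [owner]
    by_cases hi : i ∈ b
    · simp only [hi, if_true]
      by_cases hij : i = j
      · subst hij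
        simp only [if_true, blk, lt_irrefl, if_false]
        rw [mem_diagBlock_iff]
        exact Or.inr (Or.inr ⟨hi, r, c, rfl⟩)
      · simp only [hij, if_false]
        by_cases hlt : i < j
        · simp only [hlt, if_true, blk]
          rw [mem_pairBlock_iff, mem_pairBody_iff]
          exact Or.inr (Or.inr (Or.inr (Or.inl ⟨hi, mem_topPath_iff.2 ⟨r, c, rfl⟩⟩)))
        · simp only [hlt, if_false, blk]
          have hgt : j < i := lt_of_le_of_ne (not_lt.1 hlt) (Ne.symm hij)
          simp only [hgt, if_true]
          rw [mem_pairBlock_iff, mem_pairBody_iff]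
          exact Or.inr (Or.inr (Or.inr (Or.inr ⟨hi, mem_topPath_iff.2 ⟨r, c, rfl⟩⟩)))
    · simp only [hi, if_false, blk]
      rw [mem_chainBlock_iff]
      exact Or.inr (Or.inr ⟨hi, j, r, c, rfl⟩)
  | d t => simp [owner, blk]

/-- **… and in no other block**: membership determines the key. [folklore] -/
theorem owner_eq_of_mem_blk {u v : GV n pad} (h : v ∈ blk b u) : owner b v = u := by
  cases u with
  | g i s =>
    cases s
    · simp only [blk] at h
      rw [mem_chainBlock_iff] at h
      rcases h with rfl | rfl | ⟨hi, j, r, c, rfl⟩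
      · rfl
      · rfl
      · simp [owner, hi]
    · simp [blk] at h
  | a i j c =>
    simp only [blk] at h
    by_cases hji : j < i
    · simp only [hji, if_true] at h
      have hij : ¬i < j := not_lt.2 hji.le
      have hne : i ≠ j := hji.ne'
      have hne' : j ≠ i := hji.ne
      split_ifs at h with hc0 hc1
      · subst hc0
        rw [mem_pairBlock_iff, mem_pairBody_iff] at h
        rcases h with rfl | rfl | (rfl | rfl | rfl) | ⟨hjb, hv⟩ | ⟨hib, hv⟩
        · simp [owner, hji]
        · simp [owner, hji]
        · simp [owner, hij, hne']
        · simp [owner, hij, hne']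
        · simp [owner, hij, hne']
        · obtain ⟨r, c, rfl⟩ := mem_topPath_iff.1 hv
          simp [owner, hjb, hne', hji]
        · obtain ⟨r, c, rfl⟩ := mem_topPath_iff.1 hv
          simp [owner, hib, hne, hij]
      · simp at h
      · simp only [List.mem_singleton] at h
        subst h
        have hc2 : c = 2 := by
          rcases c with ⟨c, hc'⟩
          simp [Fin.ext_iff] at hc0 hc1 ⊢
          omega
        simp [owner, hji, hc2]
    · simp only [hji, if_false] at h
      by_cases hij : i = j
      · subst hij
        simp only [if_true] at h
        split_ifs at h with hc0 hc1
        · subst hc0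
          rw [mem_diagBlock_iff] at h
          rcases h with rfl | rfl | ⟨hib, r, c, rfl⟩
          · simp [owner]
          · simp [owner]
          · simp [owner, hib]
        · simp at h
        · simp only [List.mem_singleton] at h
          subst h
          have hc2 : c = 2 := by
            rcases c with ⟨c, hc'⟩
            simp [Fin.ext_iff] at hc0 hc1 ⊢
            omega
          simp [owner, hc2]
      · simp [hij] at h
  | x i j r c => simp [blk] at h
  | d t =>
    simp only [blk, List.mem_singleton] at h
    subst h
    rfl

/-- Membership in a block, characterised. [folklore] -/
theorem mem_blk_iff_owner {u v : GV n pad} : v ∈ blk b u ↔ owner b v = u :=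
  ⟨owner_eq_of_mem_blk b, fun h => h ▸ mem_blk_owner b v⟩

/-! ### Blocks have no repetitions -/

/-- [folklore] -/
theorem nodup_chainBlock (i : Fin n) : (chainBlock b i : List (GV n pad)).Nodup := by
  unfold chainBlock
  rw [List.nodup_cons, List.nodup_append]
  split_ifs with hi
  · simp
  · refine ⟨?_, nodup_chainTail i n le_rfl, by simp, ?_⟩
    · rw [List.mem_append, mem_chainBody_iff]
      simp
    · intro v hv w hw hvw
      subst hvw
      obtain ⟨j, r, c, rfl⟩ := (mem_chainBody_iff i _).1 hv
      simp at hw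

/-- [folklore] -/
theorem nodup_pairBody (y x' : Fin n) (hyx : y < x') : (pairBody b y x' : List (GV n pad)).Nodup := by
  have hne : y ≠ x' := hyx.ne
  have hne' : x' ≠ y := hyx.ne'
  unfold pairBody
  split_ifs <;> simp [topPath, hne, hne']

/-- [folklore] -/
theorem nodup_pairBlock (y x' : Fin n) (hyx : y < x') : (pairBlock b y x' : List (GV n pad)).Nodup := by
  have hne : y ≠ x' := hyx.ne
  have hne' : x' ≠ y := hyx.ne'
  unfold pairBlock
  rw [List.nodup_cons, List.nodup_append]
  refine ⟨?_, nodup_pairBody b y x' hyx, by simp, ?_⟩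
  · rw [List.mem_append, mem_pairBody_iff, mem_topPath_iff, mem_topPath_iff]
    simp [hne, hne']
  · intro v hv w hw hvw
    subst hvw
    simp only [List.mem_singleton] at hw
    subst hw
    rw [mem_pairBody_iff, mem_topPath_iff, mem_topPath_iff] at hv
    simp [hne, hne'] at hv

/-- [folklore] -/
theorem nodup_diagBlock (i : Fin n) : (diagBlock b i : List (GV n pad)).Nodup := by
  unfold diagBlock
  split_ifs <;> simp [topPath]

/-- **Blocks have no repeated vertex.** [folklore] -/
theorem nodup_blk (u : GV n pad) : (blk b u).Nodup := by
  cases u with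
  | g i s =>
    cases s
    · exact nodup_chainBlock b i
    · simp [blk]
  | a i j c =>
    simp only [blk]
    split_ifs with h1 h2 h3 h4 h5 h6
    · exact nodup_pairBlock b j i h1
    · simp
    · simp
    · exact nodup_diagBlock b i
    · simp
    · simp
    · simp
  | x i j r c => simp [blk]
  | d t => simp [blk]

/-! ### Blocks are paths of the gadget graph between skeleton vertices -/

/-- [folklore] -/
theorem isChain_chainBlock (i : Fin n) :
    List.IsChain (gadgetGraph n pad).Adj (chainBlock b i) := by
  unfold chainBlock
  split_ifs with hi
  · simp only [List.nil_append, List.isChain_cons_cons, List.IsChain.singleton, and_true]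
    exact adj_of_skel rfl rfl (by simp)
  · rw [List.isChain_cons]
    have hn : 0 < n := i.pos
    obtain ⟨m, hm⟩ : ∃ m, n = m + 1 := ⟨n - 1, by omega⟩
    refine ⟨?_, ?_⟩
    · intro v hv
      rw [List.head?_append, chainBody] at hv
      have h0 := head?_chainTail_succ (pad := pad) i m (by omega)
      have : (chainTail i n le_rfl : List (GV n pad)) = chainTail i (m + 1) (by omega) := by
        congr 1
      rw [this, h0] at hv
      simp only [Option.some_or, Option.mem_def, Option.some.injEq] at hv
      subst hv
      refine (adj_bot_iff.2 (Or.inr (Or.inl ?_))).symm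
      rw [sPrev_zero, chL_zero]
      simp only
      omega
    · refine List.IsChain.append (isChain_chainTail i n le_rfl) (List.isChain_singleton _) ?_
      intro u hu v hv
      simp only [List.head?_cons, Option.mem_def, Option.some.injEq] at hv
      subst hv
      rw [chainBody] at hu
      have h0 := getLast?_chainTail_succ (pad := pad) i m (by omega)
      have : (chainTail i n le_rfl : List (GV n pad)) = chainTail i (m + 1) (by omega) := by
        congr 1
      rw [this, h0] at hu
      simp only [Option.mem_def, Option.some.injEq] at hu
      subst hu
      refine adj_bot_iff.2 (Or.inr (Or.inr ?_))
      rw [sNext_three, chR_last]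
      simp only
      omega

/-- The top row of `X_(i,j)` hangs between its anchors: `ancL – topPath – ancR – ⋯` is a path
whenever `ancR – ⋯` is. [folklore] -/
theorem isChain_anc_topPath (i j : Fin n) {l : List (GV n pad)}
    (hl : l.head? = some (ancR i j)) (hc : List.IsChain (gadgetGraph n pad).Adj l) :
    List.IsChain (gadgetGraph n pad).Adj (ancL i j :: (topPath i j ++ l)) := by
  rw [List.isChain_cons]
  refine ⟨?_, List.IsChain.append (isChain_adj_topPath i j) hc ?_⟩
  · intro v hv
    rw [List.head?_append, head?_topPath] at hv
    simp only [Option.some_or, Option.mem_def, Option.some.injEq] at hv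
    subst hv
    exact (adj_top_iff.2 (Or.inr (Or.inl (tPrev_zero i j).symm))).symm
  · intro u hu v hv
    rw [getLast?_topPath] at hu
    rw [hl] at hv
    simp only [Option.mem_def, Option.some.injEq] at hu hv
    subst hu; subst hv
    exact adj_top_iff.2 (Or.inr (Or.inr (tNext_three i j).symm))

/-- `P – topPath y x – Q – ⋯` for `y < x`. [folklore] -/
theorem isChain_P_topPath {y x' : Fin n} (hyx : y < x') {l : List (GV n pad)}
    (hl : l.head? = some (a y x' 1)) (hc : List.IsChain (gadgetGraph n pad).Adj l) :
    List.IsChain (gadgetGraph n pad).Adj (a y x' 0 :: (topPath y x' ++ l)) := by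
  have h := isChain_anc_topPath y x' (l := l) (by rw [hl, ancR_of_le _ _ hyx.le]) hc
  rwa [ancL_of_le _ _ hyx.le] at h

/-- `Q – topPath x y – R – ⋯` for `y < x`. [folklore] -/
theorem isChain_Q_topPath {y x' : Fin n} (hyx : y < x') {l : List (GV n pad)}
    (hl : l.head? = some (a y x' 2)) (hc : List.IsChain (gadgetGraph n pad).Adj l) :
    List.IsChain (gadgetGraph n pad).Adj (a y x' 1 :: (topPath x' y ++ l)) := by
  have h := isChain_anc_topPath x' y (l := l) (by rw [hl, ancR_of_gt _ _ hyx]) hc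
  rwa [ancL_of_gt _ _ hyx] at h

/-- `a i i 0 – topPath i i – a i i 1 – ⋯`. [folklore] -/
theorem isChain_diag_topPath (i : Fin n) {l : List (GV n pad)}
    (hl : l.head? = some (a i i 1)) (hc : List.IsChain (gadgetGraph n pad).Adj l) :
    List.IsChain (gadgetGraph n pad).Adj (a i i 0 :: (topPath i i ++ l)) := by
  have h := isChain_anc_topPath i i (l := l) (by rw [hl, ancR_of_le _ _ le_rfl]) hc
  rwa [ancL_of_le _ _ le_rfl] at h

/-- [folklore] -/
theorem isChain_pairBlock {y x' : Fin n} (hyx : y < x') :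
    List.IsChain (gadgetGraph n pad).Adj (pairBlock b y x') := by
  have hne : y ≠ x' := hyx.ne
  have hne' : x' ≠ y := hyx.ne'
  unfold pairBlock pairBody
  split_ifs with hy hx
  · rw [List.isChain_cons]
    refine ⟨fun v hv => ?_, ?_⟩
    · simp at hv; subst hv
      exact adj_of_skel rfl rfl (by simp [hne'])
    · simp only [List.cons_append, List.append_assoc, List.nil_append]
      refine isChain_P_topPath hyx rfl (isChain_Q_topPath hyx rfl ?_)
      simp only [List.isChain_cons_cons, List.IsChain.singleton, and_true]
      exact adj_of_skel rfl rfl (by simp [hne])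
  · rw [List.isChain_cons]
    refine ⟨fun v hv => ?_, ?_⟩
    · simp at hv; subst hv
      exact adj_of_skel rfl rfl (by simp [hne'])
    · simp only [List.cons_append, List.append_assoc, List.nil_append]
      rw [List.isChain_cons]
      refine ⟨fun v hv => ?_, isChain_P_topPath hyx rfl ?_⟩
      · simp at hv; subst hv
        exact adj_of_skel rfl rfl (by simp)
      · simp only [List.isChain_cons_cons, List.IsChain.singleton, and_true]
        exact adj_of_skel rfl rfl (by simp [hne])
  · rw [List.isChain_cons]
    refine ⟨fun v hv => ?_, ?_⟩
    · simp at hv; subst hv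
      exact adj_of_skel rfl rfl (by simp [hne'])
    · simp only [List.cons_append, List.append_assoc, List.nil_append]
      refine isChain_Q_topPath hyx rfl ?_
      simp only [List.isChain_cons_cons, List.IsChain.singleton, and_true]
      exact ⟨adj_of_skel rfl rfl (by simp), adj_of_skel rfl rfl (by simp [hne])⟩
  · simp only [List.cons_append, List.nil_append, List.isChain_cons_cons, List.IsChain.singleton,
      and_true]
    exact ⟨adj_of_skel rfl rfl (by simp [hne']), adj_of_skel rfl rfl (by simp),
      adj_of_skel rfl rfl (by simp), adj_of_skel rfl rfl (by simp [hne])⟩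

/-- [folklore] -/
theorem isChain_diagBlock (i : Fin n) :
    List.IsChain (gadgetGraph n pad).Adj (diagBlock b i) := by
  unfold diagBlock
  split_ifs with hi
  · exact isChain_diag_topPath i rfl (List.isChain_singleton _)
  · simp only [List.nil_append, List.isChain_cons_cons, List.IsChain.singleton, and_true]
    exact adj_of_skel rfl rfl (by simp)

/-- **Blocks are paths of the gadget graph.** [folklore] -/
theorem isChain_blk (u : GV n pad) : List.IsChain (gadgetGraph n pad).Adj (blk b u) := by
  cases u with
  | g i s =>
    cases s
    · exact isChain_chainBlock b i
    · simp [blk]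
  | a i j c =>
    simp only [blk]
    split_ifs with h1 h2 h3 h4 h5 h6
    · exact isChain_pairBlock b h1
    · simp
    · exact List.isChain_singleton _
    · exact isChain_diagBlock b i
    · simp
    · exact List.isChain_singleton _
    · simp
  | x i j r c => simp [blk]
  | d t => exact List.isChain_singleton _

/-- **A nonempty block starts at its key**, a skeleton vertex. [folklore] -/
theorem head_blk {u : GV n pad} (h : blk b u ≠ []) : (blk b u).head h = u := by
  cases u with
  | g i s =>
    cases s
    · simp [blk, chainBlock]
    · simp [blk] at h
  | a i j c =>
    simp only [blk] at h ⊢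
    split_ifs at h ⊢ with h1 h2 h3 h4 h5 h6
    · simp [pairBlock, h2]
    · simp at h
    · rfl
    · simp [diagBlock, h4, h5]
    · simp at h
    · rfl
    · simp at h
  | x i j r c => simp [blk] at h
  | d t => rfl

/-- Keys of nonempty blocks are skeleton vertices. [folklore] -/
theorem skel_of_blk_ne_nil {u : GV n pad} (h : blk b u ≠ []) : skel u = true := by
  cases u with
  | x i j r c => simp [blk] at h
  | _ => rfl

/-- **A nonempty block ends at a skeleton vertex.** [folklore] -/
theorem skel_getLast_blk {u : GV n pad} (h : blk b u ≠ []) : skel ((blk b u).getLast h) = true := by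
  cases u with
  | g i s =>
    cases s
    · simp [blk, chainBlock, List.getLast_cons]
    · simp [blk] at h
  | a i j c =>
    simp only [blk] at h ⊢
    split_ifs at h ⊢ with h1 h2 h3 h4 h5 h6
    · simp [pairBlock, List.getLast_cons]
    · simp at h
    · rfl
    · simp [diagBlock, List.getLast_cons]
    · simp at h
    · rfl
    · simp at h
  | x i j r c => simp [blk] at h
  | d t => rfl

end Literature.Barriers.PneNP
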